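import Literature.AlgebraicGeometry.Motives.AbelianVarietyFrobeniusTwist
import Literature.AlgebraicGeometry.Resolution.FiniteSubextensionDescent
import Mathlib.RingTheory.Unramified.Field
import Mathlib.RingTheory.Artinian.Module
import Mathlib.AlgebraicGeometry.Sites.Fpqc
import HarnessLib

/-!
# Descent of endomorphisms of an abelian variety from `K̄` to a finite field `K`:
# `End_K(P)` is the commutant of the Frobenius in `End_{K̄}(P_K̄)`

For an abelian variety `P` over a **finite** field `K = 𝔽_q` with Frobenius endomorphism
`π = π_P ∈ End_K(P)` (`Motives/AbelianVarietyFrobeniusTwist.frobeniusHom`), this file proves the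
statement of Tate 1966, §1 / Milne, *The Work of John Tate*, §4.3 that the base change
`End_K(P) → End_{K̄}(P_K̄)` identifies `End_K(P)` with the centraliser of `π_K̄`
(`AbelianVariety.range_baseChange_eq_centralizer_frobeniusHom`,
`AbelianVariety.exists_baseChange_eq_of_commute_frobeniusHom`), together with the finiteness
statement that every endomorphism of `P_K̄` commutes with some power `πⁿ_K̄`, `n ≥ 1`
(`AbelianVariety.exists_commute_baseChange_frobeniusHom_pow`; with `End(P_K̄)` finitely generated,
some `πᴺ_K̄` is central, `AbelianVariety.exists_forall_commute_baseChange_frobeniusHom_pow`).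
These are the Galois-descent inputs left as hypotheses in
`Motives/AbelianVarietyEndAlgebraDescent` for Tate's theorem over finite fields; the assembly is in
`Motives/TateAbelianFiniteDescentProofs`.

## Contents and proofs

* **Finite stages** (`AbelianVariety.bcTransition`, `exists_finite_stage`): a `K`-morphism
  `P_L → Y` (`L / K` algebraic, `Y` separated of finite type over `K`) factors through
  `P_L → P_E` for an intermediate field `E` finite over `K` — Görtz–Wedhorn I, Thm. 10.63 /
  EGA IV₃ 8.8.2 (i), in the tree as `Literature.AlgebraicGeometry.Resolution.morphism_descent`,
  applied to the cartesian presentations `P_L → P → Spec K ≅ Spec ⊥` (`isPullback_baseChange_bot`).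
  Hence Galois twists fixing `E` act trivially on such morphisms
  (`exists_finite_stage_galTwist_comp`), over a finite field the twist by `φ^{[E:K]}` does
  (`exists_galTwist_arithFrob_pow_comp`), and by `Motives/AbelianVarietyFrobeniusTwist` (an
  endomorphism commuting with the twist by `φⁿ` commutes with `πⁿ_K̄`) every endomorphism of `P_K̄`
  commutes with some `πⁿ_K̄`.
* **The twisted diagonals cover `Spec (E ⊗_K E)`** (`FiniteFieldDescent.twistedDiagonalCover`): for a
  finite extension `E` of the finite field `K`, the `[E:K]` surjections
  `m_k : E ⊗_K E → E`, `a ⊗ b ↦ a b^{qᵏ}`, give open immersions `Spec E → Spec (E ⊗_K E)` covering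
  it — `E ⊗_K E` is reduced (separability; Mathlib `Algebra.FormallyUnramified.isReduced_of_field`)
  and Artinian, so `Spec` of a residue-field projection is a coproduct inclusion
  (`IsArtinianRing.equivPi`, `sigmaSpec`), and every prime is some `ker m_k` because its residue
  field receives two embeddings of `E` with the same image (the roots of `T^{#E} - T`,
  `mem_range_of_pow_card_eq`), which differ by a `K`-automorphism `frobᵏ` of `E` (Mathlib
  `FiniteField.bijective_frobeniusAlgEquivOfAlgebraic_pow`). This is the finite-field case of
  `E ⊗_K E ≅ ∏_{Gal(E/K)} E`.
* **Galois descent of morphisms along `P_E → P`**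
  (`AbelianVariety.exists_bcFst_comp_eq_of_galTwist_comp`): a morphism `h : P_E → Y` invariant under
  the twists `1 × Spec frobᵏ` descends to `P`: `P_E → P` is faithfully flat and quasi-compact, hence
  an effective epimorphism of schemes (Mathlib, `AlgebraicGeometry.Sites.Fpqc`), and the cocycle
  condition `pr₁ ≫ h = pr₂ ≫ h` on the kernel pair `P_E ×_P P_E → Spec (E ⊗_K E)` is checked on the
  pulled-back twisted-diagonal cover, over whose `k`-th piece `pr₂ = pr₁ ≫ (1 × Spec frobᵏ)`
  (`comp_snd_eq_comp_fst_comp_galTwist`) — Görtz–Wedhorn I, (14.20) and Thm. 14.70 (Galois descent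
  of morphisms), for the cyclic group generated by the Frobenius.
* **From morphisms of schemes to homomorphisms** (`exists_hom_baseChange_eq_of_bcFst_comp`): a
  descended morphism whose base change underlies a homomorphism is a homomorphism, by faithfulness
  of the monoidal base-change functor (the pattern of Mathlib
  `Functor.FullyFaithful.isMonHom_preimage`).
* **Assembly** (`exists_baseChange_eq_of_commute_frobeniusHom`): an endomorphism `g` of `P_K̄`
  commuting with `π_K̄` commutes with the twists by all `φᵏ` (`Motives/AbelianVarietyFrobeniusTwist`,
  through the absolute Frobenius, an epimorphism), so `g ≫ pr_P` comes from a finite stage `P_E`,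
  is invariant there under the twists by `frobᵏ` (cancel the epimorphism `P_K̄ → P_E`), descends to
  `P`, and lifts to `f ∈ End_K(P)` with `f_K̄ = g`.

Everything is proved; the new definitions are data (`specBotIso`, `bcTransition`, `bcMapLeft`,
`kernelPairToSpecTensor`, `kernelPairCover`, `FiniteFieldDescent.frob`, `twistedMul`,
`twistedDiagonalCover`, `frobE`); no definition of a `Prop`, no named fact (D-0026).

## References

* [Tate1966Endomorphisms] J. Tate, *Endomorphisms of abelian varieties over finite fields*,
  Invent. Math. 2 (1966), 134–144, §1 (`End_k(A)` and the Frobenius; the commutant statement) —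
  not held (doi:10.1007/bf01404549); as reported in Milne, *The Work of John Tate*, §4.3
  (arXiv:1210.7459, held). [Milne2013WorkOfTate]
* [GortzWedhorn2020] U. Görtz, T. Wedhorn, *Algebraic Geometry I*, 2nd ed. (2020): Thm. 10.63
  (morphisms from a limit come from a finite stage, p. 328), (14.20) and Thm. 14.70 (Galois descent
  of morphisms), Prop. 14.57.
* [Milne1986AbelianVarieties] J. S. Milne, *Abelian Varieties*, in Cornell–Silverman (1986), §16
  (descent of the base field) and proof of Thm. 12.5 over arbitrary fields.
* [Milne2025] J. S. Milne, *Étale cohomology*, VI §13 (Frobenii).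

## Design

Same conventions as `Motives/AbelianVarietyFrobeniusTwist`: compositions into `(P.baseChange L).X.left`
are written through `bcFst` / `bcSnd` / `bcMapLeft` and compared with `baseChange_hom_ext`, so that
rewriting lemmas compose syntactically. `TensorProduct K E E` is written textually (the monoidal
`⊗` notation is open). The `Fintype` structure on the finite field entering Mathlib's
`FiniteField.frobeniusAlgEquivOfAlgebraic` is `Fintype.ofFinite K` throughout.
-/

noncomputable section

universe u

open CategoryTheory CategoryTheory.Limits AlgebraicGeometry MonoidalCategory
open scoped TensorProduct

namespace Literature.AlgebraicGeometry.Motives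

/-! ## Finite stages: morphisms out of `P_L` come from `P_E`, `E / K` finite (`L / K` algebraic) -/

namespace AbelianVariety

section FiniteStage

variable {K : Type u} [Field K] (L : Type u) [Field L] [Algebra K L] (P : AbelianVariety K)

/-- `Spec K ≅ Spec ⊥` for the bottom intermediate field `⊥ ≅ K` of `L / K` (`Spec` of
`IntermediateField.botEquiv`, through the instance `algebraOverBot`). [folklore] -/
def specBotIso : Spec (.of K) ≅ Spec (.of (⊥ : IntermediateField K L)) :=
  Scheme.Spec.mapIso (IntermediateField.botEquiv K L).toRingEquiv.toCommRingCatIso.op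

/-- The underlying morphism of `specBotIso` is `Spec (algebraMap ⊥ K)`. [folklore] -/
theorem specBotIso_hom :
    (specBotIso (K := K) L).hom =
      Spec.map (CommRingCat.ofHom (algebraMap (⊥ : IntermediateField K L) K)) := rfl

/-- `algebraMap ⊥ L = algebraMap K L ∘ algebraMap ⊥ K` (the tower `⊥ → K → L`). [folklore] -/
theorem algebraMap_bot_eq :
    algebraMap (⊥ : IntermediateField K L) L =
      (algebraMap K L).comp (algebraMap (⊥ : IntermediateField K L) K) :=
  IsScalarTower.algebraMap_eq _ K L

/-- The inclusion `⊥ ≤ E` of intermediate fields is `algebraMap K E ∘ algebraMap ⊥ K`. [folklore] -/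
theorem inclusion_bot_toRingHom_eq (E : IntermediateField K L) (hE : ⊥ ≤ E) :
    (IntermediateField.inclusion hE).toRingHom =
      (algebraMap K E).comp (algebraMap (⊥ : IntermediateField K L) K) := by
  ext x
  change (x : L) = algebraMap K L (IntermediateField.botEquiv K L x)
  exact IsScalarTower.algebraMap_apply (⊥ : IntermediateField K L) K L x

/-- **The cartesian presentation of `P_{L'}` over `Spec ⊥`**: for any `K`-algebra `L'` and a ring
homomorphism `F : ⊥ → L'` equal to `algebraMap K L' ∘ (⊥ ≅ K)`, the square
`P_{L'} → P → Spec K ≅ Spec ⊥ ← Spec L'` is cartesian (the defining square of `P_{L'}` with the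
base `Spec K` replaced by the isomorphic `Spec ⊥`). [folklore] -/
theorem isPullback_baseChange_bot (L' : Type u) [Field L'] [Algebra K L']
    (F : (⊥ : IntermediateField K L) →+* L')
    (hF : F = (algebraMap K L').comp (algebraMap (⊥ : IntermediateField K L) K)) :
    IsPullback (bcFst L' P) (bcSnd L' P) (P.X.hom ≫ (specBotIso (K := K) L).hom)
      (Spec.map (CommRingCat.ofHom F)) := by
  have h0 : IsPullback (bcFst L' P) (bcSnd L' P) P.X.hom (bcSpec K L') :=
    IsPullback.of_hasPullback _ _
  refine h0.of_iso (Iso.refl _) (Iso.refl _) (Iso.refl _) (specBotIso (K := K) L) (by simp)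
    (by simp) (by simp) ?_
  rw [Iso.refl_hom, Category.id_comp, specBotIso_hom, ← Spec.map_comp, ← CommRingCat.ofHom_comp,
    ← hF]

/-- `Spec L → Spec E → Spec K` is `Spec L → Spec K` for an intermediate field `E`. [folklore] -/
@[reassoc]
theorem specMap_algebraMap_comp_bcSpec (E : IntermediateField K L) :
    Spec.map (CommRingCat.ofHom (algebraMap (↥E) L)) ≫ bcSpec K ↥E = bcSpec K L := by
  rw [← Spec.map_comp, ← CommRingCat.ofHom_comp, ← IsScalarTower.algebraMap_eq K (↥E) L]

/-- **The transition morphism `P_L → P_E`** for an intermediate field `K ⊆ E ⊆ L`: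
`1 × Spec (E ⊆ L)`. [folklore] -/
def bcTransition (E : IntermediateField K L) : (P.baseChange L).X.left ⟶ (P.baseChange ↥E).X.left :=
  pullback.map P.X.hom (bcSpec K L) P.X.hom (bcSpec K ↥E) (𝟙 P.X.left)
    (Spec.map (CommRingCat.ofHom (algebraMap (↥E) L))) (𝟙 _) (by simp)
    (by rw [Category.comp_id, specMap_algebraMap_comp_bcSpec])

/-- `P_L → P_E → P` is `P_L → P`. [folklore] -/
@[reassoc (attr := simp)]
theorem bcTransition_fst (E : IntermediateField K L) :
    bcTransition L P E ≫ bcFst (↥E) P = bcFst L P :=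
  (pullback.lift_fst _ _ _).trans (Category.comp_id _)

/-- `P_L → P_E → Spec E` is `P_L → Spec L → Spec E`. [folklore] -/
@[reassoc (attr := simp)]
theorem bcTransition_snd (E : IntermediateField K L) :
    bcTransition L P E ≫ bcSnd (↥E) P =
      bcSnd L P ≫ Spec.map (CommRingCat.ofHom (algebraMap (↥E) L)) :=
  pullback.lift_snd _ _ _

/-- **The transition square `P_L → P_E` over `Spec L → Spec E` is cartesian** (a commutative
square between two cartesian presentations over `Spec ⊥`). [folklore] -/
theorem isPullback_bcTransition (E : IntermediateField K L) :
    IsPullback (bcTransition L P E) (bcSnd L P) (bcSnd (↥E) P)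
      (Spec.map (CommRingCat.ofHom (algebraMap (↥E) L))) := by
  have big : IsPullback (bcTransition L P E ≫ bcFst (↥E) P) (bcSnd L P) P.X.hom
      (Spec.map (CommRingCat.ofHom (algebraMap (↥E) L)) ≫ bcSpec K ↥E) := by
    rw [bcTransition_fst, specMap_algebraMap_comp_bcSpec]
    exact IsPullback.of_hasPullback _ _
  exact big.of_right (bcTransition_snd L P E) (IsPullback.of_hasPullback _ _)

/-- The transition morphism `P_L → P_E` is an epimorphism of schemes (a base change of the
faithfully flat `Spec L → Spec E`). [folklore] -/
instance epi_bcTransition (E : IntermediateField K L) : Epi (bcTransition L P E) :=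
  Resolution.epi_of_isPullback (isPullback_bcTransition L P E)

/-- The transition morphism is flat. [folklore] -/
instance flat_bcTransition (E : IntermediateField K L) : Flat (bcTransition L P E) :=
  (Resolution.isAffineHom_flat_surjective_of_isPullback (isPullback_bcTransition L P E)).2.1

/-- The transition morphism is surjective. [folklore] -/
instance surjective_bcTransition (E : IntermediateField K L) : Surjective (bcTransition L P E) :=
  (Resolution.isAffineHom_flat_surjective_of_isPullback (isPullback_bcTransition L P E)).2.2

/-- **A Galois twist fixing `E` pointwise acts trivially modulo the transition to `P_E`**:
`(1 × Spec σ) ≫ (P_L → P_E) = (P_L → P_E)` if `σ|_E = id`. [folklore] -/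
theorem galTwist_comp_bcTransition_of_fix (E : IntermediateField K L) (σ : L ≃ₐ[K] L)
    (hσ : ∀ x : E, σ x = x) : galTwist L P σ ≫ bcTransition L P E = bcTransition L P E := by
  have hring : (σ : L →+* L).comp (algebraMap (↥E) L) = algebraMap (↥E) L :=
    RingHom.ext fun x ↦ hσ x
  apply baseChange_hom_ext
  · rw [Category.assoc, bcTransition_fst, galTwist_fst]
  · rw [Category.assoc, bcTransition_snd, galTwist_snd_assoc, ← Spec.map_comp,
      ← CommRingCat.ofHom_comp, hring]

variable [Algebra.IsAlgebraic K L]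

/-- **Morphisms out of `P_L` come from a finite stage `P_E`** (`L / K` algebraic): a `K`-morphism
`u : P_L → Y` to a separated `K`-scheme locally of finite type factors as `u = (P_L → P_E) ≫ u'`
for some intermediate field `E` finite over `K` (Görtz–Wedhorn I, Thm. 10.63 / EGA IV₃ 8.8.2 (i),
in the tree as `Literature.AlgebraicGeometry.Resolution.morphism_descent`, applied to the
cartesian presentations `P_L → P → Spec K ≅ Spec ⊥` and `P_E → P`). [cite: GortzWedhorn2020, Thm. 10.63, p. 328] -/
theorem exists_finite_stage {Y : SchemeOver K} [LocallyOfFiniteType Y.hom] [IsSeparated Y.hom]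
    (u : (P.baseChange L).X.left ⟶ Y.left) (hu : u ≫ Y.hom = bcSnd L P ≫ bcSpec K L) :
    ∃ (E : IntermediateField K L) (_ : FiniteDimensional K E)
      (u' : (P.baseChange ↥E).X.left ⟶ Y.left), bcTransition L P E ≫ u' = u := by
  let ι := (specBotIso (K := K) L).hom
  haveI : LocallyOfFiniteType (P.X.hom ≫ ι) := inferInstance
  haveI : QuasiCompact (P.X.hom ≫ ι) := inferInstance
  obtain ⟨E, hE, hfin, H⟩ := Resolution.morphism_descent (k := K) (K := L) ⊥ (P.X.hom ≫ ι)
    (isPullback_baseChange_bot L P L (algebraMap _ L) (algebraMap_bot_eq L)) Y.hom u hu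
  obtain ⟨u', hu'⟩ := H (P.baseChange ↥E).X.left (bcFst (↥E) P) (bcSnd (↥E) P)
    (isPullback_baseChange_bot L P (↥E) _ (inclusion_bot_toRingHom_eq L E hE))
    (bcTransition L P E) (bcTransition_fst L P E) (bcTransition_snd L P E)
  exact ⟨E, hfin, u', hu'⟩

/-- **Galois twists fixing a finite stage act trivially on morphisms out of `P_L`**: for a
`K`-morphism `u : P_L → Y` (`Y` separated, locally of finite type) there is `E / K` finite such
that `(1 × Spec σ) ≫ u = u` for every `σ ∈ Aut(L/K)` fixing `E` pointwise. [folklore] -/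
theorem exists_finite_stage_galTwist_comp {Y : SchemeOver K} [LocallyOfFiniteType Y.hom]
    [IsSeparated Y.hom] (u : (P.baseChange L).X.left ⟶ Y.left)
    (hu : u ≫ Y.hom = bcSnd L P ≫ bcSpec K L) :
    ∃ (E : IntermediateField K L) (_ : FiniteDimensional K E),
      ∀ σ : L ≃ₐ[K] L, (∀ x : E, σ x = x) → galTwist L P σ ≫ u = u := by
  obtain ⟨E, hfin, u', hu'⟩ := exists_finite_stage L P u hu
  refine ⟨E, hfin, fun σ hσ ↦ ?_⟩
  rw [← hu', ← Category.assoc, galTwist_comp_bcTransition_of_fix L P E σ hσ]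

end FiniteStage

/-! ## Over a finite field: every endomorphism of `P_K̄` commutes with a power of `π_K̄` -/

section FiniteField

variable {K : Type u} [Field K] [Finite K] (P : AbelianVariety K)

/-- On a finite intermediate field `E` of `K̄ / K`, `φ^{[E:K]}` is the identity (`#E = q^{[E:K]}`
and `x^{#E} = x` on the finite field `E`). [folklore] -/
theorem arithFrobAlgEquiv_pow_finrank_apply (E : IntermediateField K (AlgebraicClosure K))
    [FiniteDimensional K E] (x : E) :
    (arithFrobAlgEquiv K ^ Module.finrank K E) (x : AlgebraicClosure K) = x := by
  haveI : Finite E := Module.finite_of_finite K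
  letI := Fintype.ofFinite E
  letI := Fintype.ofFinite K
  rw [arithFrobAlgEquiv_pow_apply, Nat.card_eq_fintype_card, ← Module.card_eq_pow_finrank,
    ← SubmonoidClass.coe_pow, FiniteField.pow_card]

/-- **Every `K`-morphism `u : P_K̄ → Y` (`Y` separated of finite type over the finite field `K`)
is invariant under the Galois twist by some power `φⁿ`, `n ≥ 1`, of the Frobenius** (it comes
from a finite stage `E = 𝔽_{qⁿ}`, fixed pointwise by `φⁿ`). [folklore] -/
theorem exists_galTwist_arithFrob_pow_comp {Y : SchemeOver K} [LocallyOfFiniteType Y.hom]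
    [IsSeparated Y.hom] (u : (P.baseChange (AlgebraicClosure K)).X.left ⟶ Y.left)
    (hu : u ≫ Y.hom = bcSnd (AlgebraicClosure K) P ≫ bcSpec K (AlgebraicClosure K)) :
    ∃ n : ℕ, 0 < n ∧ galTwist (AlgebraicClosure K) P (arithFrobAlgEquiv K ^ n) ≫ u = u := by
  obtain ⟨E, hfin, H⟩ := exists_finite_stage_galTwist_comp (AlgebraicClosure K) P u hu
  exact ⟨Module.finrank K E, Module.finrank_pos,
    H _ (arithFrobAlgEquiv_pow_finrank_apply E)⟩

/-- **Every endomorphism of `P_K̄` commutes, on schemes, with the twist by some `φⁿ`, `n ≥ 1`.**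
[folklore] -/
theorem exists_galTwist_comp_toSchemeHom (g : End (P.baseChange (AlgebraicClosure K))) :
    ∃ n : ℕ, 0 < n ∧
      galTwist (AlgebraicClosure K) P (arithFrobAlgEquiv K ^ n) ≫ Hom.toSchemeHom g =
        Hom.toSchemeHom g ≫ galTwist (AlgebraicClosure K) P (arithFrobAlgEquiv K ^ n) := by
  have hg : Hom.toSchemeHom g ≫ bcSnd (AlgebraicClosure K) P = bcSnd (AlgebraicClosure K) P :=
    Over.w g.hom.hom.hom
  obtain ⟨n, hn, H⟩ := exists_galTwist_arithFrob_pow_comp P (Y := P.X)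
    (Hom.toSchemeHom g ≫ bcFst (AlgebraicClosure K) P)
    (by rw [Category.assoc, bcFst_comp_hom, reassoc_of% hg])
  refine ⟨n, hn, baseChange_hom_ext _ _ ?_ ?_⟩
  · rw [Category.assoc, H, Category.assoc, galTwist_fst]
  · rw [Category.assoc, hg, galTwist_snd, Category.assoc, galTwist_snd, reassoc_of% hg]

/-- **Every endomorphism of `P_K̄` commutes with some power `(πⁿ)_K̄ = (π_K̄)ⁿ`, `n ≥ 1`, of the
base change of the Frobenius endomorphism** ("every endomorphism of `A_K̄` is defined over some
`𝔽_{qⁿ}`, over which `πⁿ` is the Frobenius": Tate 1966, §1; Milne, *The Work of John Tate*,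
§4.3.1; Mumford §21). [cite: Tate1966Endomorphisms, §1] -/
theorem exists_commute_baseChange_frobeniusHom_pow
    (g : End (P.baseChange (AlgebraicClosure K))) :
    ∃ n : ℕ, 0 < n ∧
      Commute (End.of (Hom.baseChange (AlgebraicClosure K) (frobeniusHom P)) ^ n) g := by
  obtain ⟨n, hn, H⟩ := exists_galTwist_comp_toSchemeHom P g
  exact ⟨n, hn, commute_baseChange_frobeniusHom_pow_of_galTwist_comp P n g H⟩

/-- **If `End(P_K̄)` is finitely generated, some power `(π_K̄)^N`, `N ≥ 1`, is central in
`End(P_K̄)`**: take `N` the product of exponents for a finite set of `ℤ`-module generators (the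
centraliser of `(π_K̄)^N` is a subgroup containing them). [folklore] -/
theorem exists_forall_commute_baseChange_frobeniusHom_pow
    [Module.Finite ℤ (End (P.baseChange (AlgebraicClosure K)))] :
    ∃ N : ℕ, 0 < N ∧ ∀ g : End (P.baseChange (AlgebraicClosure K)),
      Commute (End.of (Hom.baseChange (AlgebraicClosure K) (frobeniusHom P)) ^ N) g := by
  classical
  set π := End.of (Hom.baseChange (AlgebraicClosure K) (frobeniusHom P)) with hπ
  obtain ⟨s, hs⟩ := Module.Finite.fg_top (R := ℤ) (M := End (P.baseChange (AlgebraicClosure K)))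
  choose n hn hc using fun g : End (P.baseChange (AlgebraicClosure K)) ↦
    exists_commute_baseChange_frobeniusHom_pow P g
  refine ⟨∏ g ∈ s, n g, Finset.prod_pos fun g _ ↦ hn g, fun g ↦ ?_⟩
  have hmem : g ∈ Submodule.span ℤ (s : Set (End (P.baseChange (AlgebraicClosure K)))) := by
    rw [hs]; exact Submodule.mem_top
  refine Submodule.span_induction (p := fun g _ ↦ Commute (π ^ ∏ g ∈ s, n g) g)
    (fun x hx ↦ ?_) (Commute.zero_right _) (fun x y _ _ hx hy ↦ hx.add_right hy)
    (fun a x _ hx ↦ hx.smul_right a) hmem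
  obtain ⟨m, hm⟩ : n x ∣ ∏ g ∈ s, n g := Finset.dvd_prod_of_mem n hx
  rw [hm, pow_mul]
  exact (hc x).pow_left m

end FiniteField

end AbelianVariety


/-! ## Frobenius-twisted diagonals cover `Spec (E ⊗_K E)` (finite fields) -/

section TensorSplitting

variable (K : Type u) [Field K] [Finite K] (E : Type u) [Field E] [Algebra K E]

namespace FiniteFieldDescent

/-- The `q`-Frobenius `x ↦ x^q` of an algebraic extension `E` of the finite field `K = 𝔽_q`, as a
`K`-algebra automorphism (Mathlib `FiniteField.frobeniusAlgEquivOfAlgebraic`, with the `Fintype`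
structure `Fintype.ofFinite K`). [folklore] -/
def frob [Algebra.IsAlgebraic K E] : E ≃ₐ[K] E :=
  letI := Fintype.ofFinite K
  FiniteField.frobeniusAlgEquivOfAlgebraic K E

/-- `frob x = x^q`, `q = #K`. [folklore] -/
theorem frob_apply [Algebra.IsAlgebraic K E] (x : E) : frob K E x = x ^ Nat.card K := by
  letI := Fintype.ofFinite K
  rw [Nat.card_eq_fintype_card]
  rfl

/-- `frobᵏ x = x^{qᵏ}`. [folklore] -/
theorem frob_pow_apply [Algebra.IsAlgebraic K E] (k : ℕ) (x : E) :
    (frob K E ^ k) x = x ^ Nat.card K ^ k := by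
  induction k generalizing x with
  | zero => simp
  | succ k ih => rw [pow_succ, AlgEquiv.mul_apply, frob_apply, ih, ← pow_mul, ← pow_succ']

variable [FiniteDimensional K E]

/-- **Every `K`-automorphism of a finite extension `E` of the finite field `K` is a power `frobᵏ`,
`k < [E : K]`, of the Frobenius** (Mathlib `FiniteField.bijective_frobeniusAlgEquivOfAlgebraic_pow`).
[folklore] -/
theorem exists_eq_frob_pow (τ : E ≃ₐ[K] E) :
    ∃ k : ℕ, k < Module.finrank K E ∧ τ = frob K E ^ k := by
  letI := Fintype.ofFinite K
  haveI : Finite E := Module.finite_of_finite K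
  haveI : Algebra.IsAlgebraic K E := Algebra.IsAlgebraic.of_finite K E
  obtain ⟨⟨k, hk⟩, h⟩ := (FiniteField.bijective_frobeniusAlgEquivOfAlgebraic_pow K E).2 τ
  exact ⟨k, hk, h.symm⟩

/-- The twisted multiplication `m_k : E ⊗_K E → E`, `a ⊗ b ↦ a · frobᵏ(b)`. [folklore] -/
def twistedMul (k : ℕ) : TensorProduct K E E →ₐ[K] E :=
  haveI : Algebra.IsAlgebraic K E := Algebra.IsAlgebraic.of_finite K E
  Algebra.TensorProduct.productMap (AlgHom.id K E) ((frob K E ^ k : E ≃ₐ[K] E) : E →ₐ[K] E)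

/-- `m_k (a ⊗ b) = a · frobᵏ b`. [folklore] -/
@[simp]
theorem twistedMul_tmul (k : ℕ) (a b : E) :
    twistedMul K E k (a ⊗ₜ b) =
      a * (haveI : Algebra.IsAlgebraic K E := Algebra.IsAlgebraic.of_finite K E; (frob K E ^ k) b) := by
  simp [twistedMul]

/-- `m_k` is the identity on the left factor. [folklore] -/
theorem twistedMul_comp_includeLeft (k : ℕ) :
    (twistedMul K E k).toRingHom.comp
      (Algebra.TensorProduct.includeLeftRingHom : E →+* TensorProduct K E E) = RingHom.id E := by
  ext a
  simp [Algebra.TensorProduct.includeLeftRingHom]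

/-- `m_k` is `frobᵏ` on the right factor. [folklore] -/
theorem twistedMul_comp_includeRight (k : ℕ) :
    (twistedMul K E k).toRingHom.comp
        (Algebra.TensorProduct.includeRight (R := K) (A := E) (B := E) :
          E →+* TensorProduct K E E) =
      (haveI : Algebra.IsAlgebraic K E := Algebra.IsAlgebraic.of_finite K E;
        ((frob K E ^ k : E ≃ₐ[K] E) : E →+* E)) := by
  ext b
  simp

/-- `m_k` is surjective (it has the section `a ↦ a ⊗ 1`). [folklore] -/
theorem twistedMul_surjective (k : ℕ) : Function.Surjective (twistedMul K E k) :=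
  fun a ↦ ⟨a ⊗ₜ 1, by rw [twistedMul_tmul, map_one, mul_one]⟩

/-- `E ⊗_K E` is reduced (`E / K` is separable, so `E ⊗_K E` is formally unramified, hence reduced,
over the field `E`; Mathlib `Algebra.FormallyUnramified.isReduced_of_field`). [folklore] -/
instance isReduced_tensor : IsReduced (TensorProduct K E E) := by
  haveI : Algebra.FormallyUnramified K E := Algebra.FormallyUnramified.of_isSeparable K E
  exact Algebra.FormallyUnramified.isReduced_of_field E (TensorProduct K E E)

/-- `E ⊗_K E` is Artinian (finite-dimensional over `K`). [folklore] -/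
instance isArtinianRing_tensor : IsArtinianRing (TensorProduct K E E) := IsArtinianRing.of_finite K _

/-- **Every prime ideal of `E ⊗_K E` is the kernel of a twisted multiplication `m_k`, `k < [E:K]`**:
the residue field `F` of a prime `𝔭` receives two embeddings `j₁, j₂` of `E`; the image of `j₂`
consists of roots of `T^{#E} - T`, which all lie in `j₁(E)` (`mem_range_of_pow_card_eq`), so
`j₂ = j₁ ∘ τ` for a `K`-automorphism `τ = frobᵏ` of `E`, and then `𝔭 = ker (a ⊗ b ↦ a τ(b))`.
[folklore] -/
theorem exists_eq_ker_twistedMul (p : Ideal (TensorProduct K E E)) [p.IsPrime] :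
    ∃ k : ℕ, k < Module.finrank K E ∧ p = RingHom.ker (twistedMul K E k).toRingHom := by
  classical
  haveI : Algebra.IsAlgebraic K E := Algebra.IsAlgebraic.of_finite K E
  haveI : Finite E := Module.finite_of_finite K
  haveI : p.IsMaximal := IsArtinianRing.isMaximal_of_isPrime p
  letI : Field ((TensorProduct K E E) ⧸ p) := Ideal.Quotient.field p
  -- the two embeddings of `E` into the residue field
  let π : TensorProduct K E E →ₐ[K] (TensorProduct K E E) ⧸ p := Ideal.Quotient.mkₐ K p
  let j₁ : E →ₐ[K] (TensorProduct K E E) ⧸ p := π.comp Algebra.TensorProduct.includeLeft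
  let j₂ : E →ₐ[K] (TensorProduct K E E) ⧸ p := π.comp Algebra.TensorProduct.includeRight
  have hj₁ : Function.Injective j₁ := j₁.toRingHom.injective
  -- every `j₂ b` is a root of `T^{#E} - T`, hence in the range of `j₁`
  have hmem : ∀ b : E, j₂ b ∈ Set.range j₁.toRingHom := fun b ↦ by
    refine mem_range_of_pow_card_eq j₁.toRingHom ?_
    letI := Fintype.ofFinite E
    rw [Nat.card_eq_fintype_card, ← map_pow, FiniteField.pow_card]
  choose τ hτ using hmem
  -- `τ` is a `K`-algebra endomorphism of `E`, hence an automorphism `frobᵏ`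
  have hτ' : ∀ b, j₁ (τ b) = j₂ b := hτ
  let τa : E →ₐ[K] E :=
    { toFun := τ
      map_one' := hj₁ (by rw [hτ', map_one, map_one])
      map_mul' := fun a b ↦ hj₁ (by rw [hτ', map_mul, map_mul, hτ', hτ'])
      map_zero' := hj₁ (by rw [hτ', map_zero, map_zero])
      map_add' := fun a b ↦ hj₁ (by rw [hτ', map_add, map_add, hτ', hτ'])
      commutes' := fun c ↦ hj₁ (by rw [hτ', AlgHom.commutes, AlgHom.commutes]) }
  have hτa : Function.Bijective τa :=
    (Finite.injective_iff_bijective).mp fun a b hab ↦ j₂.toRingHom.injective (by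
      change j₂ a = j₂ b
      rw [← hτ', ← hτ', show τ a = τa a from rfl, hab]; rfl)
  obtain ⟨k, hk, hkτ⟩ := exists_eq_frob_pow K E (AlgEquiv.ofBijective τa hτa)
  refine ⟨k, hk, ?_⟩
  -- `π = j₁ ∘ m_k`
  have hπ : π = j₁.comp (twistedMul K E k) := by
    refine Algebra.TensorProduct.ext' fun a b ↦ ?_
    rw [AlgHom.comp_apply, twistedMul_tmul, map_mul, ← hkτ, AlgEquiv.ofBijective_apply,
      show τa b = τ b from rfl, hτ']
    change π (a ⊗ₜ b) = π (a ⊗ₜ 1) * π (1 ⊗ₜ b)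
    rw [← map_mul, Algebra.TensorProduct.tmul_mul_tmul, mul_one, one_mul]
  ext t
  rw [RingHom.mem_ker, AlgHom.toRingHom_eq_coe, AlgHom.coe_toRingHom,
    ← map_eq_zero_iff _ hj₁, ← AlgHom.comp_apply, ← hπ]
  exact (Ideal.Quotient.eq_zero_iff_mem).symm

/-- In a reduced Artinian ring, `Spec` of the projection to a residue field `R → R/𝔪` is an open
immersion (it is a coproduct inclusion of `Spec R = ∐ Spec (R/𝔪ᵢ)`, Mathlib
`IsArtinianRing.equivPi` and `sigmaSpec`). [folklore] -/
theorem isOpenImmersion_specMap_quotient_mk (R : Type u) [CommRing R] [IsArtinianRing R]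
    [IsReduced R] (I : MaximalSpectrum R) :
    IsOpenImmersion (Spec.map (CommRingCat.ofHom (Ideal.Quotient.mk I.asIdeal))) := by
  let F : MaximalSpectrum R → CommRingCat.{u} := fun J ↦ .of (R ⧸ J.asIdeal)
  let e : R →+* ((J : MaximalSpectrum R) → R ⧸ J.asIdeal) := (IsArtinianRing.equivPi R).toRingEquiv
  have he : (Pi.evalRingHom (fun J : MaximalSpectrum R ↦ R ⧸ J.asIdeal) I).comp e =
      Ideal.Quotient.mk I.asIdeal := RingHom.ext fun x ↦ rfl
  haveI : IsIso (CommRingCat.ofHom e) := by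
    change IsIso (IsArtinianRing.equivPi R).toRingEquiv.toCommRingCatIso.hom
    infer_instance
  have hfac : Spec.map (CommRingCat.ofHom (Ideal.Quotient.mk I.asIdeal)) =
      (Sigma.ι (fun J ↦ Spec (F J)) I ≫ sigmaSpec F) ≫ Spec.map (CommRingCat.ofHom e) := by
    rw [ι_sigmaSpec, ← Spec.map_comp, ← CommRingCat.ofHom_comp, he]
  haveI : IsOpenImmersion (Sigma.ι (fun J ↦ Spec (F J)) I) :=
    (sigmaOpenCover (fun J ↦ Spec (F J))).map_prop I
  rw [hfac]
  infer_instance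

/-- `Spec` of a surjection from a reduced Artinian ring onto a field is an open immersion.
[folklore] -/
theorem isOpenImmersion_specMap_of_surjective (R : Type u) [CommRing R] [IsArtinianRing R]
    [IsReduced R] (F : Type u) [Field F] (f : R →+* F) (hf : Function.Surjective f) :
    IsOpenImmersion (Spec.map (CommRingCat.ofHom f)) := by
  haveI : (RingHom.ker f).IsMaximal := RingHom.ker_isMaximal_of_surjective f hf
  let I : MaximalSpectrum R := ⟨RingHom.ker f, inferInstance⟩
  let e : R ⧸ RingHom.ker f ≃+* F := RingHom.quotientKerEquivOfSurjective hf
  have hfe : f = e.toRingHom.comp (Ideal.Quotient.mk (RingHom.ker f)) :=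
    RingHom.ext fun x ↦ (RingHom.quotientKerEquivOfSurjective_apply_mk hf x).symm
  haveI : IsIso (CommRingCat.ofHom e.toRingHom) := by
    change IsIso e.toCommRingCatIso.hom
    infer_instance
  haveI := isOpenImmersion_specMap_quotient_mk R I
  rw [hfe, CommRingCat.ofHom_comp, Spec.map_comp]
  exact inferInstance

/-- **The Frobenius-twisted diagonals `Spec m_k : Spec E → Spec (E ⊗_K E)`, `k < [E : K]`, form an
open cover** (for finite fields: `E ⊗_K E ≅ ∏_{k < [E:K]} E`, `a ⊗ b ↦ (a b^{qᵏ})_k`). [folklore] -/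
def twistedDiagonalCover : Scheme.OpenCover.{0} (Spec (.of (TensorProduct K E E))) :=
  Scheme.Cover.mkOfCovers (Fin (Module.finrank K E)) (fun _ ↦ Spec (.of E))
    (fun k ↦ Spec.map (CommRingCat.ofHom (twistedMul K E k.1).toRingHom))
    (fun x ↦ by
      obtain ⟨k, hk, hp⟩ := exists_eq_ker_twistedMul K E x.asIdeal
      refine ⟨⟨k, hk⟩, ⟨⊥, Ideal.isPrime_bot⟩, ?_⟩
      apply PrimeSpectrum.ext
      change Ideal.comap (twistedMul K E k).toRingHom ⊥ = x.asIdeal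
      rw [hp]
      rfl)
    (fun k ↦ isOpenImmersion_specMap_of_surjective (TensorProduct K E E) E _ (twistedMul_surjective K E k.1))

/-- The maps of the twisted-diagonal cover. [folklore] -/
@[simp]
theorem twistedDiagonalCover_f (k : Fin (Module.finrank K E)) :
    (twistedDiagonalCover K E).f k =
      Spec.map (CommRingCat.ofHom (twistedMul K E k.1).toRingHom) := rfl

end FiniteFieldDescent

end TensorSplitting


/-! ## Homomorphisms from base-changed ones: faithfulness of base change on group structures -/

namespace AbelianVariety

section LiftHom

variable {K : Type u} [Field K] (L : Type u) [Field L] [Algebra K L]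

/-- Base changes of `Spec L → Spec K` are epimorphisms (faithfully flat). [folklore] -/
instance epi_pullback_fst_bcSpec {Z : Scheme.{u}} (g : Z ⟶ Spec (.of K)) :
    Epi (pullback.fst g (bcSpec K L)) := by
  have hff : (CommRingCat.ofHom (algebraMap K L)).hom.FaithfullyFlat := by
    rw [CommRingCat.hom_ofHom, RingHom.faithfullyFlat_algebraMap_iff]
    infer_instance
  obtain ⟨hflat, hsurj⟩ := (flat_and_surjective_SpecMap_iff _).2 hff
  haveI : Flat (pullback.fst g (bcSpec K L)) := MorphismProperty.pullback_fst _ _ hflat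
  haveI : Surjective (pullback.fst g (bcSpec K L)) := MorphismProperty.pullback_fst _ _ hsurj
  exact Flat.epi_of_flat_of_surjective _

/-- The base-change functor `X ↦ X_L` on `K`-schemes is faithful. [folklore] -/
instance faithful_bcFunctor : (bcFunctor K L).Faithful := Over.faithful_pullback _

variable (P Q : AbelianVariety K)

/-- `P_L → P` is flat. [folklore] -/
instance flat_bcFst : Flat (bcFst L P) := by
  have hff : (CommRingCat.ofHom (algebraMap K L)).hom.FaithfullyFlat := by
    rw [CommRingCat.hom_ofHom, RingHom.faithfullyFlat_algebraMap_iff]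
    infer_instance
  rw [bcFst_def]
  exact MorphismProperty.pullback_fst _ _ ((flat_and_surjective_SpecMap_iff _).2 hff).1

/-- `P_L → P` is surjective. [folklore] -/
instance surjective_bcFst : Surjective (bcFst L P) := by
  have hff : (CommRingCat.ofHom (algebraMap K L)).hom.FaithfullyFlat := by
    rw [CommRingCat.hom_ofHom, RingHom.faithfullyFlat_algebraMap_iff]
    infer_instance
  rw [bcFst_def]
  exact MorphismProperty.pullback_fst _ _ ((flat_and_surjective_SpecMap_iff _).2 hff).2

/-- `P_L → P` is quasi-compact. [folklore] -/
instance quasiCompact_bcFst : QuasiCompact (bcFst L P) := by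
  rw [bcFst_def]
  exact MorphismProperty.pullback_fst _ _ inferInstance

/-- `P_L → P` is an epimorphism of schemes. [folklore] -/
instance epi_bcFst : Epi (bcFst L P) := Flat.epi_of_flat_of_surjective _

variable {P Q}

/-- The base change `φ_L` of a `K`-morphism `φ : P → Q` of the underlying `K`-schemes, on
underlying schemes, with source and target syntactically those of `P.baseChange L`,
`Q.baseChange L`. [folklore] -/
def bcMapLeft (φ : P.X ⟶ Q.X) : (P.baseChange L).X.left ⟶ (Q.baseChange L).X.left :=
  ((bcFunctor K L).map φ).left

/-- `bcMapLeft` is the underlying morphism of `(bcFunctor K L).map φ` (by definition). [folklore] -/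
theorem bcMapLeft_def (φ : P.X ⟶ Q.X) : bcMapLeft L φ = ((bcFunctor K L).map φ).left := rfl

/-- `φ_L ≫ pr_Q = pr_P ≫ φ`. [folklore] -/
@[reassoc]
theorem bcMapLeft_comp_bcFst (φ : P.X ⟶ Q.X) : bcMapLeft L φ ≫ bcFst L Q = bcFst L P ≫ φ.left :=
  pullback.lift_fst _ _ _

/-- `φ_L` is a morphism over `Spec L`. [folklore] -/
@[reassoc]
theorem bcMapLeft_comp_bcSnd (φ : P.X ⟶ Q.X) : bcMapLeft L φ ≫ bcSnd L Q = bcSnd L P :=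
  pullback.lift_snd _ _ _

open scoped MonObj Obj in
/-- **A `K`-morphism of the underlying schemes whose base change is (the underlying morphism of) a
homomorphism `g : P_L → Q_L` is a homomorphism `f : P → Q` with `f_L = g`**: the unit and
multiplication compatibilities hold after the faithful monoidal base change (Mathlib
`Functor.FullyFaithful.isMonHom_preimage` pattern, with faithfulness only). [folklore] -/
theorem exists_hom_baseChange_eq_of_map_eq (g : P.baseChange L ⟶ Q.baseChange L)
    (g₀ : P.X ⟶ Q.X) (hmap : (bcFunctor K L).map g₀ = g.hom.hom.hom) :
    ∃ f : P ⟶ Q, Hom.baseChange L f = g := by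
  let F := bcFunctor K L
  have h1 : F.map (η[P.X] ≫ g₀) = F.map η[Q.X] := by
    have h := IsMonHom.one_hom g.hom.hom.hom
    rw [← hmap] at h
    change (Functor.LaxMonoidal.ε F ≫ F.map η[P.X]) ≫ F.map g₀ =
      Functor.LaxMonoidal.ε F ≫ F.map η[Q.X] at h
    rw [Category.assoc, cancel_epi] at h
    rw [F.map_comp, h]
  have h2 : F.map (μ[P.X] ≫ g₀) = F.map ((g₀ ⊗ₘ g₀) ≫ μ[Q.X]) := by
    have h := IsMonHom.mul_hom g.hom.hom.hom
    rw [← hmap] at h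
    change (Functor.LaxMonoidal.μ F P.X P.X ≫ F.map μ[P.X]) ≫ F.map g₀ =
      (F.map g₀ ⊗ₘ F.map g₀) ≫ (Functor.LaxMonoidal.μ F Q.X Q.X ≫ F.map μ[Q.X]) at h
    rw [Functor.LaxMonoidal.μ_natural_assoc, Category.assoc, cancel_epi] at h
    rw [F.map_comp, F.map_comp, h]
  refine ⟨InducedCategory.homMk (Grp.homMk'' (A := P.toGrp) (B := Q.toGrp) g₀
    (F.map_injective h1) (F.map_injective h2)), hom_ext _ _ ?_⟩
  rw [Hom.baseChange_hom_hom_hom]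
  exact hmap

/-- **A homomorphism `g : P_L → Q_L` whose underlying morphism descends to a morphism
`h₀ : P → Q` of schemes (`pr_P ≫ h₀ = g ≫ pr_Q`) is a base change `f_L`**: `h₀` is a `K`-morphism
(check after the epimorphism `pr_P`), `(h₀)_L = g` on schemes (universal property of `Q_L`), and
`h₀` is a homomorphism by `exists_hom_baseChange_eq_of_map_eq`. [folklore] -/
theorem exists_hom_baseChange_eq_of_bcFst_comp (g : P.baseChange L ⟶ Q.baseChange L)
    (h₀ : P.X.left ⟶ Q.X.left) (hh₀ : bcFst L P ≫ h₀ = Hom.toSchemeHom g ≫ bcFst L Q) :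
    ∃ f : P ⟶ Q, Hom.baseChange L f = g := by
  have hsnd : Hom.toSchemeHom g ≫ bcSnd L Q = bcSnd L P := Over.w g.hom.hom.hom
  have hover : h₀ ≫ Q.X.hom = P.X.hom := by
    rw [← cancel_epi (bcFst L P), reassoc_of% hh₀, bcFst_comp_hom, reassoc_of% hsnd,
      bcFst_comp_hom]
  refine exists_hom_baseChange_eq_of_map_eq L g (Over.homMk h₀ hover) (Over.OverMorphism.ext ?_)
  change bcMapLeft L (Over.homMk h₀ hover) = Hom.toSchemeHom g
  apply baseChange_hom_ext
  · rw [bcMapLeft_comp_bcFst]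
    exact hh₀
  · rw [bcMapLeft_comp_bcSnd]
    exact hsnd.symm

end LiftHom

/-! ## Descent along `P_E → P` of morphisms invariant under the Frobenius twists (finite `E`) -/

section KernelPair

variable {K : Type u} [Field K] (L : Type u) [Field L] [Algebra K L] (P : AbelianVariety K)

/-- **The kernel pair of `P_L → P` maps to `Spec (L ⊗_K L)`**: `P_L ×_P P_L → Spec L ×_K Spec L
≅ Spec (L ⊗_K L)` (the two structure maps; Mathlib `pullbackSpecIso`). [folklore] -/
def kernelPairToSpecTensor :
    pullback (bcFst L P) (bcFst L P) ⟶ Spec (.of (TensorProduct K L L)) :=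
  pullback.lift (pullback.fst _ _ ≫ bcSnd L P) (pullback.snd _ _ ≫ bcSnd L P) (by
      rw [Category.assoc, Category.assoc, ← bcFst_comp_hom, pullback.condition_assoc,
        bcFst_comp_hom]) ≫
    (pullbackSpecIso K L L).hom

/-- First coordinate of `kernelPairToSpecTensor`: the `a ⊗ 1`-part is the structure map of the
first factor. [folklore] -/
@[reassoc]
theorem kernelPairToSpecTensor_includeLeft :
    kernelPairToSpecTensor L P ≫
        Spec.map (CommRingCat.ofHom (Algebra.TensorProduct.includeLeftRingHom :
          L →+* TensorProduct K L L)) =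
      pullback.fst _ _ ≫ bcSnd L P := by
  rw [kernelPairToSpecTensor, Category.assoc, pullbackSpecIso_hom_fst, pullback.lift_fst]

/-- Second coordinate of `kernelPairToSpecTensor`. [folklore] -/
@[reassoc]
theorem kernelPairToSpecTensor_includeRight :
    kernelPairToSpecTensor L P ≫
        Spec.map (CommRingCat.ofHom (Algebra.TensorProduct.includeRight (R := K) (A := L)
          (B := L) : L →+* TensorProduct K L L)) =
      pullback.snd _ _ ≫ bcSnd L P := by
  rw [kernelPairToSpecTensor, Category.assoc, pullbackSpecIso_hom_snd, pullback.lift_snd]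

end KernelPair

section Descent

variable {K : Type u} [Field K] [Finite K] (P : AbelianVariety K)
  (E : IntermediateField K (AlgebraicClosure K))

/-- The `q`-Frobenius of an intermediate field `E` of `K̄ / K`. [folklore] -/
abbrev frobE : ↥E ≃ₐ[K] ↥E := FiniteFieldDescent.frob K ↥E

/-- **Compatibility of the twists at the two levels**: the twist of `P_K̄` by `φᵏ` followed by the
transition to `P_E` is the transition followed by the twist of `P_E` by `frobᵏ` (both raise the
coordinates in `E` to the `qᵏ`-th power). [folklore] -/
@[reassoc]
theorem galTwist_arithFrob_pow_comp_bcTransition (k : ℕ) :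
    galTwist (AlgebraicClosure K) P (arithFrobAlgEquiv K ^ k) ≫
        bcTransition (AlgebraicClosure K) P E =
      bcTransition (AlgebraicClosure K) P E ≫ galTwist (↥E) P (frobE E ^ k) := by
  have hring : ((arithFrobAlgEquiv K ^ k : AlgebraicClosure K ≃ₐ[K] AlgebraicClosure K) :
        AlgebraicClosure K →+* AlgebraicClosure K).comp (algebraMap (↥E) (AlgebraicClosure K)) =
      (algebraMap (↥E) (AlgebraicClosure K)).comp ((frobE E ^ k : ↥E ≃ₐ[K] ↥E) : ↥E →+* ↥E) := by
    ext x
    change (arithFrobAlgEquiv K ^ k) (algebraMap (↥E) (AlgebraicClosure K) x) =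
      algebraMap (↥E) (AlgebraicClosure K) ((frobE E ^ k) x)
    rw [arithFrobAlgEquiv_pow_apply, FiniteFieldDescent.frob_pow_apply, map_pow]
  apply baseChange_hom_ext
  · rw [Category.assoc, bcTransition_fst, galTwist_fst, Category.assoc, galTwist_fst,
      bcTransition_fst]
  · rw [Category.assoc, bcTransition_snd, galTwist_snd_assoc, Category.assoc, galTwist_snd,
      bcTransition_snd_assoc, ← Spec.map_comp, ← Spec.map_comp, ← CommRingCat.ofHom_comp,
      ← CommRingCat.ofHom_comp, hring]

variable [FiniteDimensional K E]

/-- The open cover of the kernel pair `P_E ×_P P_E` pulled back from the twisted-diagonal cover of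
`Spec (E ⊗_K E)`. [folklore] -/
def kernelPairCover : Scheme.OpenCover.{0} (pullback (bcFst (↥E) P) (bcFst (↥E) P)) :=
  (FiniteFieldDescent.twistedDiagonalCover K ↥E).pullback₁ (kernelPairToSpecTensor (↥E) P)

/-- **Over the `k`-th twisted diagonal, the second projection of the kernel pair is the first
projection followed by the twist by `frobᵏ`**: if `z : Z → P_E ×_P P_E` maps into
`Spec E --Spec m_k--> Spec (E ⊗_K E)`, then `z ≫ pr₂ = z ≫ pr₁ ≫ (1 × Spec frobᵏ)`
(`P_E ×_P P_E ≅ ∐_k P_E` with `pr₂ = 1 × Spec frobᵏ` on the `k`-th copy: the Galois descent datum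
for the cyclic group generated by the Frobenius; Görtz–Wedhorn I, (14.20)).
[cite: GortzWedhorn2020, (14.20)] -/
theorem comp_snd_eq_comp_fst_comp_galTwist {Z : Scheme.{u}}
    (z : Z ⟶ pullback (bcFst (↥E) P) (bcFst (↥E) P)) (w : Z ⟶ Spec (.of ↥E)) (k : ℕ)
    (hcond : z ≫ kernelPairToSpecTensor (↥E) P =
      w ≫ Spec.map (CommRingCat.ofHom (FiniteFieldDescent.twistedMul K (↥E) k).toRingHom)) :
    z ≫ pullback.snd (bcFst (↥E) P) (bcFst (↥E) P) =
      z ≫ pullback.fst (bcFst (↥E) P) (bcFst (↥E) P) ≫ galTwist (↥E) P (frobE E ^ k) := by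
  have hfst : z ≫ pullback.fst _ _ ≫ bcSnd (↥E) P = w := by
    rw [← kernelPairToSpecTensor_includeLeft, reassoc_of% hcond, ← Spec.map_comp,
      ← CommRingCat.ofHom_comp, FiniteFieldDescent.twistedMul_comp_includeLeft,
      CommRingCat.ofHom_id]
    erw [Spec.map_id]
    exact Category.comp_id _
  have hsnd : z ≫ pullback.snd _ _ ≫ bcSnd (↥E) P =
      w ≫ Spec.map (CommRingCat.ofHom ((frobE E ^ k : ↥E ≃ₐ[K] ↥E) : ↥E →+* ↥E)) := by
    rw [← kernelPairToSpecTensor_includeRight, reassoc_of% hcond, ← Spec.map_comp,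
      ← CommRingCat.ofHom_comp, FiniteFieldDescent.twistedMul_comp_includeRight]
  apply baseChange_hom_ext
  · rw [Category.assoc, Category.assoc, Category.assoc, galTwist_fst, ← pullback.condition]
  · rw [Category.assoc, Category.assoc, Category.assoc, galTwist_snd, hsnd, ← hfst]
    simp only [Category.assoc]

/-- **The cocycle condition for Frobenius-twist-invariant morphisms**: if `h : P_E → Y` satisfies
`(1 × Spec frobᵏ) ≫ h = h` for all `k`, then `pr₁ ≫ h = pr₂ ≫ h` on `P_E ×_P P_E` (check on the open
cover by the twisted copies of `P_E`). [folklore] -/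
theorem fst_comp_eq_snd_comp_of_galTwist_comp {Y : Scheme.{u}} (h : (P.baseChange ↥E).X.left ⟶ Y)
    (hh : ∀ k : ℕ, galTwist (↥E) P (frobE E ^ k) ≫ h = h) :
    pullback.fst (bcFst (↥E) P) (bcFst (↥E) P) ≫ h = pullback.snd _ _ ≫ h :=
  Scheme.Cover.hom_ext (kernelPairCover P E) _ _ fun k ↦ by
    have H : (kernelPairCover P E).f k ≫ pullback.snd (bcFst (↥E) P) (bcFst (↥E) P) =
        (kernelPairCover P E).f k ≫ pullback.fst (bcFst (↥E) P) (bcFst (↥E) P) ≫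
          galTwist (↥E) P (frobE E ^ k.1) :=
      comp_snd_eq_comp_fst_comp_galTwist P E _ (pullback.snd _ _) k.1 pullback.condition
    rw [← Category.assoc, ← Category.assoc, H, Category.assoc, Category.assoc, Category.assoc, hh]

/-- **Galois descent of morphisms along `P_E → P` for the finite field extension `E / K`**: a
morphism `h : P_E → Y` invariant under the twists `1 × Spec frobᵏ` descends uniquely to `P`,
`h = pr_P ≫ h₀` — `pr_P` is faithfully flat and quasi-compact, hence an effective epimorphism of
schemes (Mathlib, `AlgebraicGeometry.Sites.Fpqc`), and the cocycle condition on the kernel pair is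
`fst_comp_eq_snd_comp_of_galTwist_comp` (Görtz–Wedhorn I, Thm. 14.70 / (14.20), Galois descent of
morphisms; Milne 1986, §16). [cite: GortzWedhorn2020, (14.20)] -/
theorem exists_bcFst_comp_eq_of_galTwist_comp {Y : Scheme.{u}} (h : (P.baseChange ↥E).X.left ⟶ Y)
    (hh : ∀ k : ℕ, galTwist (↥E) P (frobE E ^ k) ≫ h = h) :
    ∃ h₀ : P.X.left ⟶ Y, bcFst (↥E) P ≫ h₀ = h :=
  ⟨EffectiveEpi.desc (bcFst (↥E) P) h fun g₁ g₂ hg ↦ by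
      rw [← pullback.lift_fst g₁ g₂ hg, Category.assoc,
        fst_comp_eq_snd_comp_of_galTwist_comp P E h hh, pullback.lift_snd_assoc],
    EffectiveEpi.fac _ _ _⟩

end Descent

/-! ## Endomorphisms of `P_K̄` commuting with `π_K̄` are defined over the finite field `K` -/

section FiniteField

variable {K : Type u} [Field K] [Finite K] (P : AbelianVariety K)

/-- **An endomorphism of `P_K̄` commuting with the base change `π_K̄` of the Frobenius
endomorphism is the base change of an endomorphism of `P`** (`K` finite). Proof: commuting with
`π_K̄` (hence with all `πᵏ_K̄`) means commuting with the Galois twists by `φᵏ`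
(`galTwist_comp_toSchemeHom_of_commute`: both are compared through the absolute Frobenius, an
epimorphism); the `K`-morphism `g ≫ pr_P : P_K̄ → P` comes from a finite stage `P_E`
(`exists_finite_stage`), where it is invariant under the twists by `frobᵏ` (cancel the
epimorphism `P_K̄ → P_E`), so it descends to `h₀ : P → P` (`exists_bcFst_comp_eq_of_galTwist_comp`),
and `h₀` is a homomorphism with `(h₀)_K̄ = g` (`exists_hom_baseChange_eq_of_bcFst_comp`).
(Tate 1966, §1: `End_k(A)` is the commutant of `π` in `End_{k̄}(A)`; Milne, *The Work of John
Tate*, §4.3.) [cite: Tate1966Endomorphisms, §1] -/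
theorem exists_baseChange_eq_of_commute_frobeniusHom
    (g : End (P.baseChange (AlgebraicClosure K)))
    (hg : Commute (End.of (Hom.baseChange (AlgebraicClosure K) (frobeniusHom P))) g) :
    ∃ f : End P, Hom.baseChange (AlgebraicClosure K) f = g := by
  -- `g` commutes with all twists by powers of the arithmetic Frobenius
  have hT : ∀ k : ℕ, galTwist (AlgebraicClosure K) P (arithFrobAlgEquiv K ^ k) ≫ Hom.toSchemeHom g =
      Hom.toSchemeHom g ≫ galTwist (AlgebraicClosure K) P (arithFrobAlgEquiv K ^ k) :=
    fun k ↦ galTwist_comp_toSchemeHom_of_commute P k g (hg.pow_left k)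
  -- the `K`-morphism `h = g ≫ pr_P : P_K̄ → P` and its finite stage
  set h := Hom.toSchemeHom g ≫ bcFst (AlgebraicClosure K) P with hh
  have hsnd : Hom.toSchemeHom g ≫ bcSnd (AlgebraicClosure K) P = bcSnd (AlgebraicClosure K) P :=
    Over.w g.hom.hom.hom
  have hinv : ∀ k : ℕ, galTwist (AlgebraicClosure K) P (arithFrobAlgEquiv K ^ k) ≫ h = h :=
    fun k ↦ by rw [hh, ← Category.assoc, hT, Category.assoc, galTwist_fst]
  obtain ⟨E, hfin, hE, hhE⟩ := exists_finite_stage (AlgebraicClosure K) P (Y := P.X) h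
    (by rw [hh, Category.assoc, bcFst_comp_hom, reassoc_of% hsnd])
  haveI := hfin
  -- invariance at the finite level
  have hinvE : ∀ k : ℕ, galTwist (↥E) P (frobE E ^ k) ≫ hE = hE := fun k ↦ by
    rw [← cancel_epi (bcTransition (AlgebraicClosure K) P E),
      ← galTwist_arithFrob_pow_comp_bcTransition_assoc, hhE, hinv]
  -- descent to `P` and lift to a homomorphism
  obtain ⟨h₀, hh₀⟩ := exists_bcFst_comp_eq_of_galTwist_comp P E hE hinvE
  refine exists_hom_baseChange_eq_of_bcFst_comp (AlgebraicClosure K) g h₀ ?_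
  rw [← bcTransition_fst (AlgebraicClosure K) P E, Category.assoc, hh₀, hhE, bcTransition_fst]

/-- The same for any power `πⁿ_K̄`, `n ≥ 1`?  No: commuting with `πⁿ_K̄` only gives descent to
`𝔽_{qⁿ}`. For `n = 1` see `exists_baseChange_eq_of_commute_frobeniusHom`; this lemma records the
converse inclusion: base changes commute with `π_K̄`. [folklore] -/
theorem commute_baseChange_frobeniusHom_baseChange (f : End P) :
    Commute (End.of (Hom.baseChange (AlgebraicClosure K) (frobeniusHom P)))
      (Hom.baseChange (AlgebraicClosure K) f) := by
  change _ * _ = _ * _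
  rw [End.mul_def, End.mul_def]
  change Hom.baseChange _ f ≫ Hom.baseChange _ (frobeniusHom P) =
    Hom.baseChange _ (frobeniusHom P) ≫ Hom.baseChange _ f
  rw [← Hom.baseChange_comp, ← Hom.baseChange_comp, frobeniusHom_comp]

/-- **`End_K(P)` is the commutant of `π_K̄` in `End_{K̄}(P_K̄)`** (Tate 1966, §1), as an equality
of subsets of `End(P_K̄)`: the range of base change equals the centraliser of `π_K̄`.
[cite: Tate1966Endomorphisms, §1] -/
theorem range_baseChange_eq_centralizer_frobeniusHom :
    Set.range (fun f : End P ↦ Hom.baseChange (AlgebraicClosure K) f) =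
      {g | Commute (End.of (Hom.baseChange (AlgebraicClosure K) (frobeniusHom P))) g} := by
  ext g
  constructor
  · rintro ⟨f, rfl⟩
    exact commute_baseChange_frobeniusHom_baseChange P f
  · exact fun hg ↦ exists_baseChange_eq_of_commute_frobeniusHom P g hg

end FiniteField

end AbelianVariety

end Literature.AlgebraicGeometry.Motives
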